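import Literature.MathematicalPhysics.QuantumFieldTheory.Balaban1983to89.B4Lemma24HolderRateUnif
import Literature.MathematicalPhysics.QuantumFieldTheory.Balaban1983to89.B4Thm19ZeroBoxHolder

/-!
# `Balaban1983to89.B4Thm19ZeroBoxHolderRateUnif` — [B4] Theorem p. 573, the Hölder clause (1.9) at `A = 0` on rectangular
# parallelepipeds, WITH THE PRINTED QUANTIFIER ORDER «there exist positive constants δ₀, c₀, R₀ independent of A, k, Ω
# and depending on d, M only, c₀ on α also»: ONE decay rate `δ₀` for ALL `0 ≤ α < 1` — the chain of
# `…B4Thm19ZeroBoxHolder` (`green_blockRowHolder_bound → Gfine_blockRowHolder_bound → step_termH_bound → Gfine_rowwH_bound →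
# thm19_zero_box_holder_roww(_coeff)`) RE-THREADED on top of `…B4Lemma24HolderRateUnif` (`_unif` twins; proofs = the
# originals with the `∃`-witnesses reordered)

statement-level skeleton of published theorems with citation tags; proofs where landed; nothing here is a claim about the Yang–Mills mass gap

T. Bałaban, *Regularity and decay of lattice Green's functions*, Commun. Math. Phys. **89** (1983) 571–597
[Balaban1983RegularityDecay] («[B4]»).  PDF held `paper:balaban1983-cmp89-regularity-decay` (journal page = PDF page + 570):
p. 573 [PDF 3] (Theorem, (1.9)), p. 582 [PDF 12] ((2.34), Lemma 2.4 (2.36), (2.38)), p. 583 [PDF 13] ((2.39)).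

CITATION HEADER (lean-in-tree rule).  Cell `lit-balaban` (HOME `run/shared/lean/pub/lit-balaban/`), unit `lit-balaban-r03`
gen 13 (B6 fold owner; free-target protocol G.5-34(d): row **B4.Thm@573** cells, owner r01 notified; consumer row
**B6.Prop2.2**).  File 2 of the `_unif` re-threading (file 1 = `…B4Lemma24HolderRateUnif`: `greenBoxQ_holder_decay_236_inv_unif`).
A NEW LEAF on `…B4Thm19ZeroBoxHolder` (pre-cell pub-balaban lineage; its `wsum2`, `blockRowDD_real`, `Gfine_blockRow_bound`-type
inputs via `…B4Thm110ZeroBox(Deriv)`, `weight_smul_mul3_row_dd`, `sc`/`bj`/`ej`/`Mj`/`Nf` scale bookkeeping, `Lratio_lt_one`,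
`holderWeight_le`, `aSeq_window`, `boxOpR_L_inv_decay`, `cov237_box_decay` are consumed BY NAME); NOTHING existing is
modified.  THEOREMS ONLY — no definition, no `def … : Prop` fact.

WHAT IS PRINTED.  p. 573: «**Theorem** (Proposition 2.1 of [1]). For α < 1 there exist positive constants δ₀, c₀, R₀
independent of A, k, Ω and depending on d, M only, c₀ on α also, such that for e sufficiently small and for an arbitrary
function f : Ω → R^N, we have |x − x′|^{−α}|U(A(Γ_{x,x′}))(D^η_{A,μ}G_k(Ω, A)f)(x′) − (D^η_{A,μ}G_k(Ω, A)f)(x)| ≤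
c₀ exp(−δ₀ dist({x, x′}, supp f))‖f‖_∞ (1.9) […] For some simple sets Ω, e.g. for rectangular parallelepipeds, the
inequalities hold without any restrictions on the points x, x′».  p. 583: «where the constant c′₁ is built of c₀, c₁,
Σ_{x∈Z^d} e^{−δ₀|x|}, Σ_{j=1}^∞ (L^{−j})^{1−α}» — the `α`-dependence sits in the CONSTANT (the geometric series of (2.39));
the rate `δ₀` «depending on d, M only».

WHY / WHAT.  `…B4Thm19ZeroBoxHolder` states (1.9) at `A = 0` as `∀ α ∃ (δ₀, c₀)`, although its proof takes `δ₀ =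
min(r/2, κ₀)` from `α`-free decay rates (`boxOpR_L_inv_decay`, `Gfine_blockRow_bound`, `cov237_box_decay`) and the
(2.36)-rate — which `…B4Lemma24HolderRateUnif` now delivers uniformly in `α`.  This file repeats the four proofs with the
witnesses reordered:
* §1 `green_blockRowHolder_bound_unif`, `Gfine_blockRowHolder_bound_unif` — `∃ κ ∀ α ∃ C(α)`;
* §2 `step_termH_bound_unif` — `∃ κ₀ ∀ α ∃ Θ(α) ∀ δ₀ ≤ κ₀ …`; `Gfine_rowwH_bound_unif` — `∃ δ₀ ∀ α ∃ c₀(α)` (the constant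
  carries the series `q(α)/(1 − q(α))`, `q(α) = L^α/L`);
* §3 **`thm19_zero_box_holder_roww_unif`**, **`thm19_zero_box_holder_roww_coeff_unif`** — (1.9) at `A = 0` on boxes, the
  two-centre weighted row form consumed by the [B6] two-level Hölder entry 4 (`…B6Ineq243HolderTwoLevelBox`), with ONE
  `δ₀` for all `α`.
HONEST SCOPE.  Exactly that of `…B4Thm19ZeroBoxHolder` (A = 0, U ≡ 1, one component, boxes, `k ≥ 1`, windows
`a ∈ [a₋, a₊]`, `m² ∈ [0, m²₊]`; `δ₀` depends on `(d, L, a₋, a₊, m²₊)`, `c₀` on these and `α`); the value/derivative clauses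
(1.10) are `α`-free already (`…B4Thm110ZeroBox(Deriv)`); the column («Dual») companion `…B4Thm19ZeroBoxHolderDual` is
re-threaded in a sibling file.  No new estimate — a change of quantifier order justified by the existing proofs.  NOT
summit progress.
-/

namespace Literature.MathematicalPhysics.QuantumFieldTheory.Balaban1983to89.B4Thm19ZeroBoxHolderRateUnif

open Finset Matrix
open Literature.MathematicalPhysics.QuantumFieldTheory.Balaban1983to89.B4ContourShift
open Literature.MathematicalPhysics.QuantumFieldTheory.Balaban1983to89.B4Reflection242
open Literature.MathematicalPhysics.QuantumFieldTheory.Balaban1983to89.B4Green242Bridge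
open Literature.MathematicalPhysics.QuantumFieldTheory.Balaban1983to89.B4BoxCov237
open Literature.MathematicalPhysics.QuantumFieldTheory.Balaban1983to89.B4Thm110ZeroBox
open Literature.MathematicalPhysics.QuantumFieldTheory.Balaban1983to89.B4Thm110ZeroBoxDeriv
open Literature.MathematicalPhysics.QuantumFieldTheory.Balaban1983to89.B4Thm19ZeroBoxHolder
open Literature.MathematicalPhysics.QuantumFieldTheory.Balaban1983to89.B4Lemma24HolderRateUnif
open B4StripSumsHolder (one_le_supNorm)
open B4Sect5Torus (IsPseudoDist SumBound Hyp56 rate rate_pos inv_decay)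
open B4Sect5Proof (latticeConst latticeConst_nonneg latticeSum_le)

noncomputable section

variable {d : ℕ}

/-! ## §1 (2.36) on the box and its transport to the fine box, one rate for all `α` -/

/-- **(2.36) real form on a box, rate uniform in `α`** — `B4Thm19ZeroBoxHolder.green_blockRowHolder_bound` in print's order `∃ κ ∀ α ∃ C(α)` (from `greenBoxQ_holder_decay_236_inv_unif`). [cite: Balaban1983RegularityDecay, p. 582 Lemma 2.4 (2.36)] -/
theorem green_blockRowHolder_bound_unif (d : ℕ) (aminus aplus m2plus : ℝ) (ha : 0 < aminus) :
    ∃ κ : ℝ, 0 < κ ∧ ∀ (α : ℝ), 0 ≤ α → α < 1 → ∃ C : ℝ, 0 ≤ C ∧ ∀ (n : ℕ), 1 ≤ n → ∀ (a m2 : ℝ), aminus ≤ a → a ≤ aplus → 0 ≤ m2 → m2 ≤ m2plus →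
      ∀ (M : Fin (d + 1) → ℕ), (∀ i, 1 ≤ M i) →
        ∀ (μ : Fin (d + 1)) (x xe x' xe' : ↥(boxDom (fun i => n * M i))), xe.1 = x.1 + Pi.single μ 1 →
          xe'.1 = x'.1 + Pi.single μ 1 → x'.1 ≠ x.1 →
        ∀ (y : Fin (d + 1) → ℤ), y ∈ boxDom M →
          ((n : ℝ) / supNorm (x'.1 - x.1)) ^ α *
              |(n : ℝ) * ∑ x'' : ↥(boxDom (fun i => n * M i)),
                (if blk n x''.1 = y then ((boxOpR n a m2 M)⁻¹ xe' x'' - (boxOpR n a m2 M)⁻¹ x' x'')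
                  - ((boxOpR n a m2 M)⁻¹ xe x'' - (boxOpR n a m2 M)⁻¹ x x'') else 0)|
            ≤ C * Real.exp (-(κ * min (supNorm (blk n x.1 - y)) (supNorm (blk n x'.1 - y)))) := by
  obtain ⟨κ, hκ, hA⟩ := greenBoxQ_holder_decay_236_inv_unif d aminus aplus m2plus ha
  refine ⟨κ, hκ, fun α hα0 hα1 => ?_⟩
  obtain ⟨C, hC, h⟩ := hA α hα0 hα1
  refine ⟨C, hC, fun n hn a m2 h1 h2 h3 h4 M hM μ x xe x' xe' hxe hxe' hne y hy => ?_⟩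
  have hb := (h n hn a m2 h1 h2 h3 h4 M hM).2 μ x xe x' xe' hxe hxe' hne y hy
  rw [blockRowDD_real hn (lt_of_lt_of_le ha h1) h3 hM, Complex.norm_real, Real.norm_eq_abs] at hb
  exact hb

/-- **Transport of (2.36) to the fine box with the factor `s_j^α s_j^{-1} = (L^jη)^{1−α}`, rate uniform in `α`** — `B4Thm19ZeroBoxHolder.Gfine_blockRowHolder_bound` in print's order `∃ κ ∀ α ∃ C(α)`. [cite: Balaban1983RegularityDecay, p. 582 Lemma 2.4 (2.36), (2.38)] -/
theorem Gfine_blockRowHolder_bound_unif (d ℓ : ℕ) (hℓ : 1 ≤ ℓ) (aminus aplus m2plus : ℝ) (ha : 0 < aminus) :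
    ∃ κ : ℝ, 0 < κ ∧ ∀ (α : ℝ), 0 ≤ α → α < 1 → ∃ C : ℝ, 0 ≤ C ∧ ∀ (k j : ℕ), 1 ≤ j → ∀ (hj : j + 1 ≤ k), ∀ (a m2 : ℝ), aminus ≤ a → a ≤ aplus →
      0 ≤ m2 → m2 ≤ m2plus → ∀ (M : Fin (d + 1) → ℕ), (∀ i, 1 ≤ M i) →
        ∀ (μ : Fin (d + 1)) (x xe x' xe' : ↥(boxDom (Nf ℓ k M))), xe.1 = x.1 + Pi.single μ 1 →
          xe'.1 = x'.1 + Pi.single μ 1 → x'.1 ≠ x.1 →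
        ∀ (y : Fin (d + 1) → ℤ), y ∈ boxDom (Mj ℓ k M j) →
          ((((ℓ + 1) ^ k : ℕ) : ℝ) / supNorm (x'.1 - x.1)) ^ α *
            |(((ℓ + 1) ^ k : ℕ) : ℝ) * ∑ x'' : ↥(boxDom (Nf ℓ k M)),
              (if blk (bj ℓ j) x''.1 = y then
                (Gfine ℓ k M j a m2 xe' x'' - Gfine ℓ k M j a m2 x' x'')
                  - (Gfine ℓ k M j a m2 xe x'' - Gfine ℓ k M j a m2 x x'') else 0)|
            ≤ sc ℓ k j ^ α * (sc ℓ k j)⁻¹ * C *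
                Real.exp (-(κ * min (supNorm (blk (bj ℓ j) x.1 - y)) (supNorm (blk (bj ℓ j) x'.1 - y)))) := by
  obtain ⟨κ, hκ, hA⟩ := green_blockRowHolder_bound_unif d (aminus * (1 - ((((ℓ : ℝ) + 1)) ^ 2)⁻¹))
    aplus m2plus (aminus'_pos hℓ ha)
  refine ⟨κ, hκ, fun α hα0 hα1 => ?_⟩
  obtain ⟨C, hC, h⟩ := hA α hα0 hα1
  refine ⟨C, hC, fun k j hj1 hj a m2 h1 h2 h3 h4 M hM μ x xe x' xe' hxe hxe' hne y hy => ?_⟩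
  have ha0 : 0 < a := lt_of_lt_of_le ha h1
  obtain ⟨hw1, hw2, hapos⟩ := aSeq_window hℓ ha h1 h2 hj1
  have hs : 0 < sc ℓ k j ^ 2 := pow_pos (sc_pos ℓ k j) 2
  have hsc0 : sc ℓ k j ≠ 0 := (sc_pos ℓ k j).ne'
  have hm' : 0 ≤ m2 / sc ℓ k j ^ 2 := div_nonneg h3 hs.le
  have hm'' : m2 / sc ℓ k j ^ 2 ≤ m2plus := (div_le_self h3 (one_le_pow₀ (one_le_sc ℓ k j))).trans h4
  have hxe1 : ((ej ℓ k M j hj).symm xe).1 = ((ej ℓ k M j hj).symm x).1 + Pi.single μ 1 := hxe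
  have hxe1' : ((ej ℓ k M j hj).symm xe').1 = ((ej ℓ k M j hj).symm x').1 + Pi.single μ 1 := hxe'
  have hne1 : ((ej ℓ k M j hj).symm x').1 ≠ ((ej ℓ k M j hj).symm x).1 := hne
  have hrow := h (bj ℓ j) (bj_pos ℓ j) _ _ hw1 hw2 hm' hm'' (Mj ℓ k M j) (Mj_pos hM) μ
    ((ej ℓ k M j hj).symm x) ((ej ℓ k M j hj).symm xe) ((ej ℓ k M j hj).symm x') ((ej ℓ k M j hj).symm xe')
    hxe1 hxe1' hne1 y hy
  have hxv : ((ej ℓ k M j hj).symm x).1 = x.1 := rfl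
  have hxv' : ((ej ℓ k M j hj).symm x').1 = x'.1 := rfl
  rw [hxv, hxv'] at hrow
  -- the weight `(n/|σ|)^α·|n·S|` of the scale-`j` box, `n = b_j`
  set W : ℝ := (((bj ℓ j : ℕ) : ℝ) / supNorm (x'.1 - x.1)) ^ α with hW
  have hσ1 : 1 ≤ supNorm (x'.1 - x.1) := one_le_supNorm (sub_ne_zero.2 hne)
  have hσ0 : 0 < supNorm (x'.1 - x.1) := lt_of_lt_of_le one_pos hσ1
  have hW0 : 0 ≤ W := Real.rpow_nonneg (div_nonneg (Nat.cast_nonneg _) hσ0.le) α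
  have hsum : ∑ x'' : ↥(boxDom (Nf ℓ k M)),
      (if blk (bj ℓ j) x''.1 = y then
        (Gfine ℓ k M j a m2 xe' x'' - Gfine ℓ k M j a m2 x' x'')
          - (Gfine ℓ k M j a m2 xe x'' - Gfine ℓ k M j a m2 x x'') else 0)
      = (sc ℓ k j ^ 2)⁻¹ * ∑ z : ↥(boxDom (fun i => bj ℓ j * Mj ℓ k M j i)),
          (if blk (bj ℓ j) z.1 = y then
            ((boxOpR (bj ℓ j) (B1.aSeq a ((ℓ : ℝ) + 1) j) (m2 / sc ℓ k j ^ 2) (Mj ℓ k M j))⁻¹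
                ((ej ℓ k M j hj).symm xe') z
              - (boxOpR (bj ℓ j) (B1.aSeq a ((ℓ : ℝ) + 1) j) (m2 / sc ℓ k j ^ 2) (Mj ℓ k M j))⁻¹
                ((ej ℓ k M j hj).symm x') z)
            - ((boxOpR (bj ℓ j) (B1.aSeq a ((ℓ : ℝ) + 1) j) (m2 / sc ℓ k j ^ 2) (Mj ℓ k M j))⁻¹
                ((ej ℓ k M j hj).symm xe) z
              - (boxOpR (bj ℓ j) (B1.aSeq a ((ℓ : ℝ) + 1) j) (m2 / sc ℓ k j ^ 2) (Mj ℓ k M j))⁻¹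
                ((ej ℓ k M j hj).symm x) z) else 0) := by
    rw [sum_Nf_eq_sum_ej hj, Finset.mul_sum]
    refine Finset.sum_congr rfl fun z _ => ?_
    have hzv : (ej ℓ k M j hj z).1 = z.1 := rfl
    rw [hzv]
    split_ifs with hz
    · rw [Gfine_apply hℓ hj1 hj hM ha0 h3, Gfine_apply hℓ hj1 hj hM ha0 h3, Gfine_apply hℓ hj1 hj hM ha0 h3,
        Gfine_apply hℓ hj1 hj hM ha0 h3, Equiv.symm_apply_apply]
      ring
    · rw [mul_zero]
  have hnR : ((((ℓ + 1) ^ k : ℕ)) : ℝ) = sc ℓ k j * ((bj ℓ j : ℕ) : ℝ) := Lk_eq_sc_mul_bj (by omega)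
  have heq : ∀ S : ℝ, (((ℓ + 1) ^ k : ℕ) : ℝ) * ((sc ℓ k j ^ 2)⁻¹ * S)
      = (sc ℓ k j)⁻¹ * (((bj ℓ j : ℕ) : ℝ) * S) := by
    intro S
    rw [hnR]
    field_simp
  -- the Hölder weight of the fine box splits as `s_j^α · W`
  have hwt : ((((ℓ + 1) ^ k : ℕ) : ℝ) / supNorm (x'.1 - x.1)) ^ α = sc ℓ k j ^ α * W := by
    rw [hW, hnR, mul_div_assoc, Real.mul_rpow (sc_pos ℓ k j).le (div_nonneg (Nat.cast_nonneg _) hσ0.le)]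
  rw [hsum, heq, abs_mul, abs_of_pos (inv_pos.2 (sc_pos ℓ k j)), hwt]
  have hsα : 0 ≤ sc ℓ k j ^ α := Real.rpow_nonneg (sc_pos ℓ k j).le α
  calc sc ℓ k j ^ α * W * ((sc ℓ k j)⁻¹ * |((bj ℓ j : ℕ) : ℝ) * _|)
      = sc ℓ k j ^ α * (sc ℓ k j)⁻¹ * (W * |((bj ℓ j : ℕ) : ℝ) * _|) := by ring
    _ ≤ sc ℓ k j ^ α * (sc ℓ k j)⁻¹ *
        (C * Real.exp (-(κ * min (supNorm (blk (bj ℓ j) x.1 - y)) (supNorm (blk (bj ℓ j) x'.1 - y))))) :=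
        mul_le_mul_of_nonneg_left hrow (mul_nonneg hsα (inv_pos.2 (sc_pos ℓ k j)).le)
    _ = _ := by ring

/-! ## §2 The (2.34)/(2.38) induction with an `α`-free rate cap -/

set_option maxHeartbeats 1600000 in
/-- **The Hölder-differenced step bound of the (2.34)/(2.38) induction, admissible rate cap uniform in `α`** — `B4Thm19ZeroBoxHolder.step_termH_bound` in the order `∃ κ₀ ∀ α ∃ Θ(α) ∀ δ₀ ≤ κ₀`: the cap `κ₀ = min(min κ κ′) δ/2` is built from the `α`-free rates of `Gfine_blockRow_bound`, `Gfine_blockRowHolder_bound_unif`, `cov237_box_decay`. [cite: Balaban1983RegularityDecay, (2.34) p.582, (2.38)–(2.39) pp.582–583] -/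
theorem step_termH_bound_unif (d ℓ : ℕ) (hℓ : 1 ≤ ℓ) (amin aplus m2plus : ℝ) (ha : 0 < amin) :
    ∃ κ₀ : ℝ, 0 < κ₀ ∧ ∀ (α : ℝ), 0 ≤ α → α < 1 → ∃ Θ : ℝ, 0 ≤ Θ ∧ ∀ (δ₀ : ℝ), 0 ≤ δ₀ → δ₀ ≤ κ₀ →
      ∀ (k j : ℕ), 1 ≤ j → ∀ (hj : j + 1 ≤ k), ∀ (a m2 : ℝ), amin ≤ a → a ≤ aplus → 0 ≤ m2 →
        m2 ≤ m2plus → ∀ (M : Fin (d + 1) → ℕ), (∀ i, 1 ≤ M i) →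
        ∀ (μ : Fin (d + 1)) (x xe x' xe' : ↥(boxDom (Nf ℓ k M))), xe.1 = x.1 + Pi.single μ 1 →
          xe'.1 = x'.1 + Pi.single μ 1 → x'.1 ≠ x.1 →
          wsum2 δ₀ ((ℓ + 1) ^ k) x x' (fun z => ((((ℓ + 1) ^ k : ℕ) : ℝ) / supNorm (x'.1 - x.1)) ^ α *
              ((((ℓ + 1) ^ k : ℕ) : ℝ) *
                (((Gfine ℓ k M (j + 1) a m2 - Gfine ℓ k M j a m2) xe' z
                    - (Gfine ℓ k M (j + 1) a m2 - Gfine ℓ k M j a m2) x' z)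
                  - ((Gfine ℓ k M (j + 1) a m2 - Gfine ℓ k M j a m2) xe z
                    - (Gfine ℓ k M (j + 1) a m2 - Gfine ℓ k M j a m2) x z))))
            ≤ Θ * Real.exp δ₀ * (sc ℓ k j ^ α * (sc ℓ k j)⁻¹) := by
  obtain ⟨κ, C₁, hκ, hC₁, hR⟩ := Gfine_blockRow_bound d ℓ hℓ amin aplus m2plus ha
  obtain ⟨κ', hκ', hHfA⟩ := Gfine_blockRowHolder_bound_unif d ℓ hℓ amin aplus m2plus ha
  obtain ⟨δ, c₂, hδ, hc₂, hCov⟩ := cov237_box_decay d ℓ hℓ (amin * (1 - ((((ℓ : ℝ) + 1)) ^ 2)⁻¹)) aplus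
    m2plus amin aplus (aminus'_pos hℓ ha) ha
  have hK0 : ∀ t : ℝ, 0 < t → 0 ≤ latticeConst (d + 1) t := fun t ht => latticeConst_nonneg _ ht.le
  have hκ₁ : 0 < min κ κ' := lt_min hκ hκ'
  have hKκ := hK0 _ (half_pos hκ₁)
  have hKδ := hK0 _ (half_pos hδ)
  refine ⟨min (min κ κ') δ / 2, by positivity, fun α hα0 hα1 => ?_⟩
  obtain ⟨C', hC', hHf⟩ := hHfA α hα0 hα1
  refine ⟨2 * (aplus ^ 2 * (C' * c₂ * C₁)
      * (latticeConst (d + 1) (min κ κ' / 2) * latticeConst (d + 1) (δ / 2)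
          * latticeConst (d + 1) (min κ κ' / 2))), ?_, ?_⟩
  · exact mul_nonneg (by norm_num) (mul_nonneg (mul_nonneg (sq_nonneg _)
      (mul_nonneg (mul_nonneg hC' hc₂.le) hC₁)) (mul_nonneg (mul_nonneg hKκ hKδ) hKκ))
  intro δ₀ hδ0 hδ1 k j hj1 hj a m2 h1 h2 h3 h4 M hM μ x xe x' xe' hxe hxe' hne
  have ha0 : 0 < a := lt_of_lt_of_le ha h1
  obtain ⟨hw1, hw2, hapos⟩ := aSeq_window hℓ ha h1 h2 hj1
  have hs : 0 < sc ℓ k j ^ 2 := pow_pos (sc_pos ℓ k j) 2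
  have hsi : 0 < (sc ℓ k j ^ 2)⁻¹ := inv_pos.2 hs
  have hs1i : 0 < (sc ℓ k j)⁻¹ := inv_pos.2 (sc_pos ℓ k j)
  have hsα : 0 ≤ sc ℓ k j ^ α := Real.rpow_nonneg (sc_pos ℓ k j).le α
  have hP0 : 0 ≤ sc ℓ k j ^ α * (sc ℓ k j)⁻¹ * C' := mul_nonneg (mul_nonneg hsα hs1i.le) hC'
  have hsc0 : sc ℓ k j ≠ 0 := (sc_pos ℓ k j).ne'
  have hm' : 0 ≤ m2 / sc ℓ k j ^ 2 := div_nonneg h3 hs.le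
  have hm'' : m2 / sc ℓ k j ^ 2 ≤ m2plus :=
    (div_le_self h3 (one_le_pow₀ (one_le_sc ℓ k j))).trans h4
  have hb1 : 1 ≤ bj ℓ j := bj_pos ℓ j
  have hbD : (0 : ℝ) < ((bj ℓ j : ℕ) : ℝ) ^ (d + 1) := by positivity
  have hδκ : δ₀ ≤ min κ κ' / 2 := hδ1.trans (by linarith [min_le_left (min κ κ') δ])
  have hδδ : δ₀ ≤ δ / 2 := hδ1.trans (by linarith [min_le_right (min κ κ') δ])
  -- the Hölder weight of the pair
  set W : ℝ := ((((ℓ + 1) ^ k : ℕ) : ℝ) / supNorm (x'.1 - x.1)) ^ α with hW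
  have hσ1 : 1 ≤ supNorm (x'.1 - x.1) := one_le_supNorm (sub_ne_zero.2 hne)
  have hW0 : 0 ≤ W := Real.rpow_nonneg (div_nonneg (Nat.cast_nonneg _) (le_trans zero_le_one hσ1)) α
  -- the doubly differenced, weighted block-row vector `g_H`
  set gH : ↥(boxDom (Mj ℓ k M j)) → ℝ := fun y => W * ((((ℓ + 1) ^ k : ℕ) : ℝ) *
      ((Amat ℓ k M j a m2 xe' y - Amat ℓ k M j a m2 x' y)
        - (Amat ℓ k M j a m2 xe y - Amat ℓ k M j a m2 x y))) with hgH
  have hg : ∀ y : ↥(boxDom (Mj ℓ k M j)), |gH y|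
      ≤ sc ℓ k j ^ α * (sc ℓ k j)⁻¹ * C' *
          Real.exp (-(min κ κ' *
            min (supNorm (blk (bj ℓ j) x.1 - y.1)) (supNorm (blk (bj ℓ j) x'.1 - y.1)))) := by
    intro y
    have hAd : (Amat ℓ k M j a m2 xe' y - Amat ℓ k M j a m2 x' y)
        - (Amat ℓ k M j a m2 xe y - Amat ℓ k M j a m2 x y)
        = ∑ x'', (if blk (bj ℓ j) x''.1 = y.1 then
            (Gfine ℓ k M j a m2 xe' x'' - Gfine ℓ k M j a m2 x' x'')
              - (Gfine ℓ k M j a m2 xe x'' - Gfine ℓ k M j a m2 x x'') else 0) := by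
      simp only [Amat, Matrix.mul_apply, QksM, Matrix.of_apply, mul_ite, mul_one, mul_zero]
      rw [← Finset.sum_sub_distrib, ← Finset.sum_sub_distrib, ← Finset.sum_sub_distrib]
      refine Finset.sum_congr rfl fun x'' _ => ?_
      split_ifs <;> ring
    have habs : |gH y| = W * |(((ℓ + 1) ^ k : ℕ) : ℝ) * ∑ x'', (if blk (bj ℓ j) x''.1 = y.1 then
            (Gfine ℓ k M j a m2 xe' x'' - Gfine ℓ k M j a m2 x' x'')
              - (Gfine ℓ k M j a m2 xe x'' - Gfine ℓ k M j a m2 x x'') else 0)| := by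
      rw [hgH]
      dsimp only
      rw [hAd, abs_mul, abs_of_nonneg hW0]
    rw [habs]
    exact (hHf k j hj1 hj a m2 h1 h2 h3 h4 M hM μ x xe x' xe' hxe hxe' hne y.1 y.2).trans
      (mul_le_mul_of_nonneg_left (exp_rate_mono (min_le_right κ κ')
        (le_min (supNorm_nonneg _) (supNorm_nonneg _))) hP0)
  -- the split according to the nearer centre
  set g₁ : ↥(boxDom (Mj ℓ k M j)) → ℝ := fun y =>
    if supNorm (blk (bj ℓ j) x.1 - y.1) ≤ supNorm (blk (bj ℓ j) x'.1 - y.1) then gH y else 0 with hg₁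
  set g₂ : ↥(boxDom (Mj ℓ k M j)) → ℝ := fun y =>
    if supNorm (blk (bj ℓ j) x.1 - y.1) ≤ supNorm (blk (bj ℓ j) x'.1 - y.1) then 0 else gH y with hg₂
  have hg12 : ∀ y, gH y = g₁ y + g₂ y := by
    intro y
    simp only [hg₁, hg₂]
    split_ifs <;> simp
  have hg1 : ∀ y, |g₁ y| ≤ sc ℓ k j ^ α * (sc ℓ k j)⁻¹ * C' *
      Real.exp (-(min κ κ' * supNorm (blk (bj ℓ j) x.1 - y.1))) := by
    intro y
    simp only [hg₁]
    split_ifs with hle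
    · refine (hg y).trans (le_of_eq ?_)
      rw [min_eq_left hle]
    · rw [abs_zero]
      positivity
  have hg2 : ∀ y, |g₂ y| ≤ sc ℓ k j ^ α * (sc ℓ k j)⁻¹ * C' *
      Real.exp (-(min κ κ' * supNorm (blk (bj ℓ j) x'.1 - y.1))) := by
    intro y
    simp only [hg₂]
    split_ifs with hle
    · rw [abs_zero]
      positivity
    · refine (hg y).trans (le_of_eq ?_)
      rw [min_eq_right (le_of_lt (not_le.1 hle))]
  have hB : ∀ (y' : ↥(boxDom (Mj ℓ k M j))) (x'' : ↥(boxDom (Nf ℓ k M))),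
      |Bmat ℓ k M j a m2 y' x''| ≤ ((((bj ℓ j : ℕ) : ℝ)) ^ (d + 1))⁻¹ *
        ((sc ℓ k j ^ 2)⁻¹ * C₁ * Real.exp (-(min κ κ' * supNorm (blk (bj ℓ j) x''.1 - y'.1)))) := by
    intro y' x''
    have hBe : Bmat ℓ k M j a m2 y' x'' = ((((bj ℓ j : ℕ) : ℝ)) ^ (d + 1))⁻¹ *
        ∑ w, (if blk (bj ℓ j) w.1 = y'.1 then Gfine ℓ k M j a m2 x'' w else 0) := by
      simp only [Bmat, Matrix.mul_apply, QkM, Matrix.of_apply, Finset.mul_sum]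
      refine Finset.sum_congr rfl fun w _ => ?_
      split_ifs with hw
      · rw [(Gfine_isSymm ℓ k M j a m2).apply x'' w]
      · rw [zero_mul, mul_zero]
    rw [hBe, abs_mul, abs_of_pos (inv_pos.2 hbD)]
    refine mul_le_mul_of_nonneg_left ?_ (inv_pos.2 hbD).le
    exact (hR k j hj1 hj a m2 h1 h2 h3 h4 M hM x'' y'.1 y'.2).trans
      (mul_le_mul_of_nonneg_left (exp_rate_mono (min_le_left κ κ') (supNorm_nonneg _))
        (mul_nonneg hsi.le hC₁))
  have hC : ∀ (y y' : ↥(boxDom (Mj ℓ k M j))),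
      |Cmat ℓ k M j a m2 y y'| ≤ (sc ℓ k j ^ 2)⁻¹ * c₂ * Real.exp (-(δ * supNorm (y.1 - y'.1))) := by
    intro y y'
    have h := (hCov (bj ℓ j) hb1 _ _ a hw1 hw2 hm' hm'' h1 h2 (Mp ℓ k M j) (Mp_pos hM)).2 y y'
    rw [Cmat, Matrix.smul_apply, smul_eq_mul, abs_mul, abs_of_pos hsi, mul_assoc]
    exact mul_le_mul_of_nonneg_left h hsi.le
  -- the two triple-product estimates, about `x` and about `x′`
  have htri1 := wsum_gCB_le hj M x g₁ (Cmat ℓ k M j a m2) (Bmat ℓ k M j a m2)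
    hP0 (mul_nonneg hsi.le hc₂.le) (mul_nonneg hsi.le hC₁) hκ₁ hδ hδ0 hδκ hδδ hg1 hC hB
  have htri2 := wsum_gCB_le hj M x' g₂ (Cmat ℓ k M j a m2) (Bmat ℓ k M j a m2)
    hP0 (mul_nonneg hsi.le hc₂.le) (mul_nonneg hsi.le hC₁) hκ₁ hδ hδ0 hδκ hδδ hg2 hC hB
  -- the weighted doubly differenced row of `α_j²A_jC_jB_j`
  have hfun : (fun z => W * ((((ℓ + 1) ^ k : ℕ) : ℝ) *
        (((Gfine ℓ k M (j + 1) a m2 - Gfine ℓ k M j a m2) xe' z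
            - (Gfine ℓ k M (j + 1) a m2 - Gfine ℓ k M j a m2) x' z)
          - ((Gfine ℓ k M (j + 1) a m2 - Gfine ℓ k M j a m2) xe z
            - (Gfine ℓ k M (j + 1) a m2 - Gfine ℓ k M j a m2) x z))))
      = fun z => αj a ℓ k j ^ 2 * ((∑ y', ∑ y, g₁ y * Cmat ℓ k M j a m2 y y' * Bmat ℓ k M j a m2 y' z)
          + (∑ y', ∑ y, g₂ y * Cmat ℓ k M j a m2 y y' * Bmat ℓ k M j a m2 y' z)) := by
    funext z
    rw [Gfine_succ_sub hℓ hj1 hj hM ha0 h3, weight_smul_mul3_row_dd, ← Finset.sum_add_distrib]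
    congr 1
    refine Finset.sum_congr rfl fun y' _ => ?_
    rw [← Finset.sum_add_distrib]
    refine Finset.sum_congr rfl fun y _ => ?_
    have h12 := hg12 y
    rw [hgH] at h12
    simp only at h12
    rw [h12]
    ring
  have hα : αj a ℓ k j ^ 2 ≤ aplus ^ 2 * (sc ℓ k j ^ 2) ^ 2 := by
    unfold αj
    rw [mul_pow]
    exact mul_le_mul_of_nonneg_right (pow_le_pow_left₀ hapos.le hw2 2) (by positivity)
  rw [hfun, wsum2_mul_left _ _ _ _ (sq_nonneg _)]
  have hw2 := (wsum2_add_le δ₀ ((ℓ + 1) ^ k) x x'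
      (fun z => ∑ y', ∑ y, g₁ y * Cmat ℓ k M j a m2 y y' * Bmat ℓ k M j a m2 y' z)
      (fun z => ∑ y', ∑ y, g₂ y * Cmat ℓ k M j a m2 y y' * Bmat ℓ k M j a m2 y' z)).trans
    (add_le_add (wsum2_le_wsum_left hδ0 _ x x' _) (wsum2_le_wsum_right hδ0 _ x x' _))
  calc αj a ℓ k j ^ 2 * wsum2 δ₀ ((ℓ + 1) ^ k) x x'
        (fun z => (∑ y', ∑ y, g₁ y * Cmat ℓ k M j a m2 y y' * Bmat ℓ k M j a m2 y' z)
          + (∑ y', ∑ y, g₂ y * Cmat ℓ k M j a m2 y y' * Bmat ℓ k M j a m2 y' z))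
      ≤ (aplus ^ 2 * (sc ℓ k j ^ 2) ^ 2) *
          (sc ℓ k j ^ α * (sc ℓ k j)⁻¹ * C' * ((sc ℓ k j ^ 2)⁻¹ * c₂) * ((sc ℓ k j ^ 2)⁻¹ * C₁)
              * Real.exp δ₀ * (latticeConst (d + 1) (min κ κ' / 2) * latticeConst (d + 1) (δ / 2)
                  * latticeConst (d + 1) (min κ κ' / 2))
            + sc ℓ k j ^ α * (sc ℓ k j)⁻¹ * C' * ((sc ℓ k j ^ 2)⁻¹ * c₂) * ((sc ℓ k j ^ 2)⁻¹ * C₁)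
              * Real.exp δ₀ * (latticeConst (d + 1) (min κ κ' / 2) * latticeConst (d + 1) (δ / 2)
                  * latticeConst (d + 1) (min κ κ' / 2))) :=
        mul_le_mul hα (hw2.trans (add_le_add htri1 htri2)) (wsum2_nonneg _ _ _ _ _) (by positivity)
    _ = 2 * (aplus ^ 2 * (C' * c₂ * C₁)
          * (latticeConst (d + 1) (min κ κ' / 2) * latticeConst (d + 1) (δ / 2)
              * latticeConst (d + 1) (min κ κ' / 2)))
          * Real.exp δ₀ * (sc ℓ k j ^ α * (sc ℓ k j)⁻¹) := by
        field_simp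
        ring

set_option maxHeartbeats 1600000 in
/-- **The master Hölder row-sum estimate over the scales `j ≤ k`, rate uniform in `α`** — `B4Thm19ZeroBoxHolder.Gfine_rowwH_bound` in print's order: ONE `δ₀ = min(r/2, κ₀)` (`r` from `boxOpR_L_inv_decay`, `κ₀` from `step_termH_bound_unif`) for all `α`; the constant `B₁ + Θ(α)e^{δ₀}q(α)/(1 − q(α))`, `q(α) = L^α/L < 1` — the geometric series `Σ_j (L^{−j})^{1−α}` of (2.39), finite because `α < 1` — depends on `α`. [cite: Balaban1983RegularityDecay, (2.38)–(2.39) pp.582–583, Thm (1.9) p.573] -/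
theorem Gfine_rowwH_bound_unif (d ℓ : ℕ) (hℓ : 1 ≤ ℓ) (amin aplus m2plus : ℝ) (ha : 0 < amin) :
    ∃ δ₀ : ℝ, 0 < δ₀ ∧ ∀ (α : ℝ), 0 ≤ α → α < 1 → ∃ c₀ : ℝ, 0 < c₀ ∧ ∀ (k : ℕ), 1 ≤ k → ∀ (j : ℕ), 1 ≤ j → j ≤ k →
      ∀ (a m2 : ℝ), amin ≤ a → a ≤ aplus → 0 ≤ m2 → m2 ≤ m2plus → ∀ (M : Fin (d + 1) → ℕ),
        (∀ i, 1 ≤ M i) → ∀ (μ : Fin (d + 1)) (x xe x' xe' : ↥(boxDom (Nf ℓ k M))),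
          xe.1 = x.1 + Pi.single μ 1 → xe'.1 = x'.1 + Pi.single μ 1 → x'.1 ≠ x.1 →
          wsum2 δ₀ ((ℓ + 1) ^ k) x x' (fun z => ((((ℓ + 1) ^ k : ℕ) : ℝ) / supNorm (x'.1 - x.1)) ^ α *
              ((((ℓ + 1) ^ k : ℕ) : ℝ) * ((Gfine ℓ k M j a m2 xe' z - Gfine ℓ k M j a m2 x' z)
                - (Gfine ℓ k M j a m2 xe z - Gfine ℓ k M j a m2 x z)))) ≤ c₀ := by
  obtain ⟨r, C₀, hr, hC₀, hdec⟩ := boxOpR_L_inv_decay d ℓ hℓ (amin * (1 - ((((ℓ : ℝ) + 1)) ^ 2)⁻¹))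
    aplus m2plus (aminus'_pos hℓ ha)
  obtain ⟨κ₀, hκ₀, hstepA⟩ := step_termH_bound_unif d ℓ hℓ amin aplus m2plus ha
  set δ₀ : ℝ := min (r / 2) κ₀ with hδ₀
  have hδ0 : 0 < δ₀ := lt_min (half_pos hr) hκ₀
  have hδr : δ₀ ≤ r / 2 := min_le_left _ _
  have hδκ : δ₀ ≤ κ₀ := min_le_right _ _
  have hK1 := one_le_latticeConst d (half_pos hr)
  have hL0 : (0 : ℝ) < (ℓ : ℝ) + 1 := by positivity
  set B₁ : ℝ := 2 * (((ℓ : ℝ) + 1) ^ 2 * C₀ * (Real.exp r + 1) * latticeConst (d + 1) (r / 2)) with hB₁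
  have hB₁0 : 0 < B₁ := by positivity
  refine ⟨δ₀, hδ0, fun α hα0 hα1 => ?_⟩
  obtain ⟨Θ, hΘ, hstep⟩ := hstepA α hα0 hα1
  set q : ℝ := ((ℓ : ℝ) + 1) ^ α * (((ℓ : ℝ) + 1))⁻¹ with hq
  have hq0 : 0 < q := by positivity
  have hq1' : q < 1 := Lratio_lt_one hℓ hα1
  have hq1 : 0 < 1 - q := by linarith
  have hΘe : 0 ≤ Θ * Real.exp δ₀ := by positivity
  refine ⟨B₁ + Θ * Real.exp δ₀ * (q / (1 - q)),
    by linarith [mul_nonneg hΘe (div_nonneg hq0.le hq1.le)], ?_⟩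
  intro k hk j hj1 hjk a m2 h1 h2 h3 h4 M hM
  have ha0 : 0 < a := lt_of_lt_of_le ha h1
  have hnk : 1 ≤ (ℓ + 1) ^ k := Nat.one_le_pow _ _ (by omega)
  have hn0 : (0 : ℝ) ≤ (((ℓ + 1) ^ k : ℕ) : ℝ) := Nat.cast_nonneg _
  -- the base: entries of `𝒢_1`, scaled by `(L^k)²`
  obtain ⟨hw1, hw2, hapos⟩ := aSeq_window hℓ ha h1 h2 (le_refl 1)
  have hT : ∀ p q' : ↥(boxDom (Nf ℓ k M)),
      (((ℓ + 1) ^ k : ℕ) : ℝ) * ((((ℓ + 1) ^ k : ℕ) : ℝ) * |Gfine ℓ k M 1 a m2 p q'|)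
        ≤ ((ℓ : ℝ) + 1) ^ 2 * C₀ * Real.exp (-(r * supNorm (p.1 - q'.1))) := by
    intro p q'
    rcases Nat.lt_or_ge k 2 with hk2 | hk2
    · obtain rfl : k = 1 := by omega
      have hG : Gfine ℓ 1 M 1 a m2 = (boxOpR ((ℓ + 1) ^ 1) (B1.aSeq a ((ℓ : ℝ) + 1) 1) m2 M)⁻¹ := by
        unfold Gfine
        rw [fineOp_top]
      rw [hG]
      have hd := hdec ((ℓ + 1) ^ 1) (pow_one _) _ _ hw1 hw2 h3 h4 M p q'
      have hc1 : (((ℓ + 1) ^ 1 : ℕ) : ℝ) = (ℓ : ℝ) + 1 := by push_cast; ring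
      rw [hc1, ← mul_assoc, ← sq]
      exact (mul_le_mul_of_nonneg_left hd (by positivity)).trans (le_of_eq (by ring))
    · have hs : 0 < sc ℓ k 1 ^ 2 := pow_pos (sc_pos ℓ k 1) 2
      have hm' : 0 ≤ m2 / sc ℓ k 1 ^ 2 := div_nonneg h3 hs.le
      have hm'' : m2 / sc ℓ k 1 ^ 2 ≤ m2plus :=
        (div_le_self h3 (one_le_pow₀ (one_le_sc ℓ k 1))).trans h4
      rw [Gfine_apply hℓ (le_refl 1) hk2 hM ha0 h3 p q', abs_mul, abs_of_pos (inv_pos.2 hs), ← mul_assoc,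
        ← mul_assoc, Lk_sq_mul_sc_one_sq_inv hk]
      have hd := hdec (bj ℓ 1) (pow_one _) _ _ hw1 hw2 hm' hm'' (Mj ℓ k M 1)
        ((ej ℓ k M 1 hk2).symm p) ((ej ℓ k M 1 hk2).symm q')
      have hpv : ((ej ℓ k M 1 hk2).symm p).1 = p.1 := rfl
      have hqv : ((ej ℓ k M 1 hk2).symm q').1 = q'.1 := rfl
      rw [hpv, hqv] at hd
      exact (mul_le_mul_of_nonneg_left hd (by positivity)).trans (le_of_eq (by ring))
  -- the base: singly differenced rows against a weight `w ≤ L^k`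
  have hTD : ∀ (μ : Fin (d + 1)) (x xe : ↥(boxDom (Nf ℓ k M))), xe.1 = x.1 + Pi.single μ 1 →
      ∀ w : ℝ, 0 ≤ w → w ≤ (((ℓ + 1) ^ k : ℕ) : ℝ) →
      ∀ z : ↥(boxDom (Nf ℓ k M)),
        |w * ((((ℓ + 1) ^ k : ℕ) : ℝ) * (Gfine ℓ k M 1 a m2 xe z - Gfine ℓ k M 1 a m2 x z))|
          ≤ ((ℓ : ℝ) + 1) ^ 2 * C₀ * (Real.exp r + 1) * Real.exp (-(r * supNorm (x.1 - z.1))) := by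
    intro μ x xe hxe w hw0 hwn z
    have h1' := hT xe z
    have h2' := hT x z
    have hnb := supNorm_sub_le_nbr (x' := z.1) hxe
    have he : Real.exp (-(r * supNorm (xe.1 - z.1)))
        ≤ Real.exp r * Real.exp (-(r * supNorm (x.1 - z.1))) := by
      rw [← Real.exp_add]
      exact Real.exp_le_exp.2 (by nlinarith)
    have hLC : 0 ≤ ((ℓ : ℝ) + 1) ^ 2 * C₀ := by positivity
    calc |w * ((((ℓ + 1) ^ k : ℕ) : ℝ) * (Gfine ℓ k M 1 a m2 xe z - Gfine ℓ k M 1 a m2 x z))|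
        = w * ((((ℓ + 1) ^ k : ℕ) : ℝ) * |Gfine ℓ k M 1 a m2 xe z - Gfine ℓ k M 1 a m2 x z|) := by
          rw [abs_mul, abs_mul, abs_of_nonneg hw0, abs_of_nonneg hn0]
      _ ≤ (((ℓ + 1) ^ k : ℕ) : ℝ) * ((((ℓ + 1) ^ k : ℕ) : ℝ) *
            (|Gfine ℓ k M 1 a m2 xe z| + |Gfine ℓ k M 1 a m2 x z|)) :=
          mul_le_mul hwn (mul_le_mul_of_nonneg_left (abs_sub _ _) hn0) (by positivity) hn0
      _ = (((ℓ + 1) ^ k : ℕ) : ℝ) * ((((ℓ + 1) ^ k : ℕ) : ℝ) * |Gfine ℓ k M 1 a m2 xe z|)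
            + (((ℓ + 1) ^ k : ℕ) : ℝ) * ((((ℓ + 1) ^ k : ℕ) : ℝ) * |Gfine ℓ k M 1 a m2 x z|) := by ring
      _ ≤ ((ℓ : ℝ) + 1) ^ 2 * C₀ * Real.exp (-(r * supNorm (xe.1 - z.1)))
            + ((ℓ : ℝ) + 1) ^ 2 * C₀ * Real.exp (-(r * supNorm (x.1 - z.1))) := add_le_add h1' h2'
      _ ≤ ((ℓ : ℝ) + 1) ^ 2 * C₀ * (Real.exp r * Real.exp (-(r * supNorm (x.1 - z.1))))
            + ((ℓ : ℝ) + 1) ^ 2 * C₀ * Real.exp (-(r * supNorm (x.1 - z.1))) :=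
          add_le_add (mul_le_mul_of_nonneg_left he hLC) le_rfl
      _ = _ := by ring
  -- the inductive claim
  have main : ∀ j, 1 ≤ j → j ≤ k → ∀ (μ : Fin (d + 1)) (x xe x' xe' : ↥(boxDom (Nf ℓ k M))),
      xe.1 = x.1 + Pi.single μ 1 → xe'.1 = x'.1 + Pi.single μ 1 → x'.1 ≠ x.1 →
      wsum2 δ₀ ((ℓ + 1) ^ k) x x' (fun z => ((((ℓ + 1) ^ k : ℕ) : ℝ) / supNorm (x'.1 - x.1)) ^ α *
          ((((ℓ + 1) ^ k : ℕ) : ℝ) * ((Gfine ℓ k M j a m2 xe' z - Gfine ℓ k M j a m2 x' z)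
            - (Gfine ℓ k M j a m2 xe z - Gfine ℓ k M j a m2 x z))))
        ≤ B₁ + Θ * Real.exp δ₀ * (q * (sc ℓ k j ^ α * (sc ℓ k j)⁻¹) / (1 - q)) := by
    intro j hj1
    induction j, hj1 using Nat.le_induction with
    | base =>
      intro _ μ x xe x' xe' hxe hxe' hne
      have hσ1 : 1 ≤ supNorm (x'.1 - x.1) := one_le_supNorm (sub_ne_zero.2 hne)
      have hW0 : 0 ≤ ((((ℓ + 1) ^ k : ℕ) : ℝ) / supNorm (x'.1 - x.1)) ^ α :=
        Real.rpow_nonneg (div_nonneg hn0 (le_trans zero_le_one hσ1)) α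
      have hWn := holderWeight_le hnk hσ1 hα0 hα1.le
      have hB0 : 0 ≤ ((ℓ : ℝ) + 1) ^ 2 * C₀ * (Real.exp r + 1) := by positivity
      have hg₁ : ∀ z : ↥(boxDom (Nf ℓ k M)),
          |-(((((ℓ + 1) ^ k : ℕ) : ℝ) / supNorm (x'.1 - x.1)) ^ α *
              ((((ℓ + 1) ^ k : ℕ) : ℝ) * (Gfine ℓ k M 1 a m2 xe z - Gfine ℓ k M 1 a m2 x z)))|
            ≤ ((ℓ : ℝ) + 1) ^ 2 * C₀ * (Real.exp r + 1) * Real.exp (-(r * supNorm (x.1 - z.1))) := by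
        intro z
        rw [abs_neg]
        exact hTD μ x xe hxe _ hW0 hWn z
      have hg₂ : ∀ z : ↥(boxDom (Nf ℓ k M)),
          |((((ℓ + 1) ^ k : ℕ) : ℝ) / supNorm (x'.1 - x.1)) ^ α *
              ((((ℓ + 1) ^ k : ℕ) : ℝ) * (Gfine ℓ k M 1 a m2 xe' z - Gfine ℓ k M 1 a m2 x' z))|
            ≤ ((ℓ : ℝ) + 1) ^ 2 * C₀ * (Real.exp r + 1) * Real.exp (-(r * supNorm (x'.1 - z.1))) :=
        fun z => hTD μ x' xe' hxe' _ hW0 hWn z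
      have hsplit := wsum2_split_le hδ0.le ((ℓ + 1) ^ k) x x'
        (fun z => ((((ℓ + 1) ^ k : ℕ) : ℝ) / supNorm (x'.1 - x.1)) ^ α *
          ((((ℓ + 1) ^ k : ℕ) : ℝ) * ((Gfine ℓ k M 1 a m2 xe' z - Gfine ℓ k M 1 a m2 x' z)
            - (Gfine ℓ k M 1 a m2 xe z - Gfine ℓ k M 1 a m2 x z))))
        (fun z => -(((((ℓ + 1) ^ k : ℕ) : ℝ) / supNorm (x'.1 - x.1)) ^ α *
          ((((ℓ + 1) ^ k : ℕ) : ℝ) * (Gfine ℓ k M 1 a m2 xe z - Gfine ℓ k M 1 a m2 x z))))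
        (fun z => ((((ℓ + 1) ^ k : ℕ) : ℝ) / supNorm (x'.1 - x.1)) ^ α *
          ((((ℓ + 1) ^ k : ℕ) : ℝ) * (Gfine ℓ k M 1 a m2 xe' z - Gfine ℓ k M 1 a m2 x' z)))
        (fun z => by ring)
      have hpos : 0 ≤ Θ * Real.exp δ₀ * (q * (sc ℓ k 1 ^ α * (sc ℓ k 1)⁻¹) / (1 - q)) :=
        mul_nonneg hΘe (div_nonneg (mul_nonneg hq0.le (mul_nonneg (Real.rpow_nonneg (sc_pos ℓ k 1).le α)
          (inv_pos.2 (sc_pos ℓ k 1)).le)) hq1.le)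
      calc _ ≤ _ := hsplit
        _ ≤ ((ℓ : ℝ) + 1) ^ 2 * C₀ * (Real.exp r + 1) * latticeConst (d + 1) (r / 2)
              + ((ℓ : ℝ) + 1) ^ 2 * C₀ * (Real.exp r + 1) * latticeConst (d + 1) (r / 2) :=
            add_le_add (wsum_le_of_decay hnk x hB0 hr hδ0.le hδr hg₁)
              (wsum_le_of_decay hnk x' hB0 hr hδ0.le hδr hg₂)
        _ = B₁ := by rw [hB₁]; ring
        _ ≤ B₁ + Θ * Real.exp δ₀ * (q * (sc ℓ k 1 ^ α * (sc ℓ k 1)⁻¹) / (1 - q)) := by linarith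
    | succ j hj1 ih =>
      intro hjk μ x xe x' xe' hxe hxe' hne
      have hprev := ih (by omega) μ x xe x' xe' hxe hxe' hne
      have hst := hstep δ₀ hδ0.le hδκ k j hj1 hjk a m2 h1 h2 h3 h4 M hM μ x xe x' xe' hxe hxe' hne
      have hsplit : (fun z => ((((ℓ + 1) ^ k : ℕ) : ℝ) / supNorm (x'.1 - x.1)) ^ α *
            ((((ℓ + 1) ^ k : ℕ) : ℝ) * ((Gfine ℓ k M (j + 1) a m2 xe' z - Gfine ℓ k M (j + 1) a m2 x' z)
              - (Gfine ℓ k M (j + 1) a m2 xe z - Gfine ℓ k M (j + 1) a m2 x z))))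
          = fun z => ((((ℓ + 1) ^ k : ℕ) : ℝ) / supNorm (x'.1 - x.1)) ^ α *
              ((((ℓ + 1) ^ k : ℕ) : ℝ) *
                (((Gfine ℓ k M (j + 1) a m2 - Gfine ℓ k M j a m2) xe' z
                    - (Gfine ℓ k M (j + 1) a m2 - Gfine ℓ k M j a m2) x' z)
                  - ((Gfine ℓ k M (j + 1) a m2 - Gfine ℓ k M j a m2) xe z
                    - (Gfine ℓ k M (j + 1) a m2 - Gfine ℓ k M j a m2) x z)))
            + ((((ℓ + 1) ^ k : ℕ) : ℝ) / supNorm (x'.1 - x.1)) ^ α *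
              ((((ℓ + 1) ^ k : ℕ) : ℝ) * ((Gfine ℓ k M j a m2 xe' z - Gfine ℓ k M j a m2 x' z)
                - (Gfine ℓ k M j a m2 xe z - Gfine ℓ k M j a m2 x z))) := by
        funext z
        simp only [Matrix.sub_apply]
        ring
      rw [hsplit]
      calc _ ≤ _ := wsum2_add_le _ _ _ _ _ _
        _ ≤ Θ * Real.exp δ₀ * (sc ℓ k j ^ α * (sc ℓ k j)⁻¹)
              + (B₁ + Θ * Real.exp δ₀ * (q * (sc ℓ k j ^ α * (sc ℓ k j)⁻¹) / (1 - q))) :=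
            add_le_add hst hprev
        _ = B₁ + Θ * Real.exp δ₀ * (q * (sc ℓ k (j + 1) ^ α * (sc ℓ k (j + 1))⁻¹) / (1 - q)) := by
            rw [sc_rpow_mul_inv_succ hjk α, ← hq]
            field_simp
            ring
  intro μ x xe x' xe' hxe hxe' hne
  have hm := main j hj1 hjk μ x xe x' xe' hxe hxe' hne
  have hs1 : sc ℓ k j ^ α * (sc ℓ k j)⁻¹ ≤ 1 := sc_rpow_mul_inv_le_one ℓ k j hα1.le
  have hgeo : q * (sc ℓ k j ^ α * (sc ℓ k j)⁻¹) / (1 - q) ≤ q / (1 - q) :=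
    div_le_div_of_nonneg_right (mul_le_of_le_one_right hq0.le hs1) hq1.le
  have hfin := mul_le_mul_of_nonneg_left hgeo hΘe
  linarith

/-! ## §3 Theorem (1.9) at `A = 0` on boxes in print's quantifier order -/

/-- **THEOREM (1.9) OF [B4] AT `A = 0` ON RECTANGULAR PARALLELEPIPEDS — THE MASTER TWO-CENTRE ROW ESTIMATE WITH THE PRINTED QUANTIFIER ORDER** «there exist positive constants δ₀, c₀, R₀ independent of A, k, Ω and depending on d, M only, c₀ on α also» (p. 573): `∃ δ₀ > 0 ∀ α ∈ [0,1) ∃ c₀(α) > 0 ∀ k ≥ 1, (a, m²) in the window, boxes, μ, x ≠ x′ with μ-neighbours in the box: Σ_z (L^k/|x′−x|_∞)^α·|L^k((G(xe′,z) − G(x′,z)) − (G(xe,z) − G(x,z)))|·e^{δ₀ min(|x−z|_∞,|x′−z|_∞)/L^k} ≤ c₀(α)` — `B4Thm19ZeroBoxHolder.thm19_zero_box_holder_roww` re-threaded. [cite: Balaban1983RegularityDecay, Theorem (Prop. 2.1 of [1]) (1.9) p.573; Lemma 2.4 (2.36) p.582; (2.38)–(2.39) pp.582–583] -/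
theorem thm19_zero_box_holder_roww_unif (d ℓ : ℕ) (hℓ : 1 ≤ ℓ) (amin aplus m2plus : ℝ) (ha : 0 < amin) :
    ∃ δ₀ : ℝ, 0 < δ₀ ∧ ∀ (α : ℝ), 0 ≤ α → α < 1 → ∃ c₀ : ℝ, 0 < c₀ ∧ ∀ (k : ℕ), 1 ≤ k → ∀ (a m2 : ℝ), amin ≤ a → a ≤ aplus → 0 ≤ m2 →
      m2 ≤ m2plus → ∀ (M : Fin (d + 1) → ℕ), (∀ i, 1 ≤ M i) →
        ∀ (μ : Fin (d + 1)) (x xe x' xe' : ↥(boxDom (fun i => (ℓ + 1) ^ k * M i))),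
          xe.1 = x.1 + Pi.single μ 1 → xe'.1 = x'.1 + Pi.single μ 1 → x'.1 ≠ x.1 →
          ∑ z, |((((ℓ + 1) ^ k : ℕ) : ℝ) / supNorm (x'.1 - x.1)) ^ α * ((((ℓ + 1) ^ k : ℕ) : ℝ) *
                (((boxOpR ((ℓ + 1) ^ k) (B1.aSeq a ((ℓ : ℝ) + 1) k) m2 M)⁻¹ xe' z
                    - (boxOpR ((ℓ + 1) ^ k) (B1.aSeq a ((ℓ : ℝ) + 1) k) m2 M)⁻¹ x' z)
                  - ((boxOpR ((ℓ + 1) ^ k) (B1.aSeq a ((ℓ : ℝ) + 1) k) m2 M)⁻¹ xe z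
                    - (boxOpR ((ℓ + 1) ^ k) (B1.aSeq a ((ℓ : ℝ) + 1) k) m2 M)⁻¹ x z)))|
              * Real.exp (δ₀ * min (supNorm (x.1 - z.1)) (supNorm (x'.1 - z.1)) / (((ℓ + 1) ^ k : ℕ) : ℝ))
            ≤ c₀ := by
  obtain ⟨δ₀, hδ, hA⟩ := Gfine_rowwH_bound_unif d ℓ hℓ amin aplus m2plus ha
  refine ⟨δ₀, hδ, fun α hα0 hα1 => ?_⟩
  obtain ⟨c₀, hc, h⟩ := hA α hα0 hα1
  refine ⟨c₀, hc, fun k hk a m2 h1 h2 h3 h4 M hM μ x xe x' xe' hxe hxe' hne => ?_⟩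
  have hG : Gfine ℓ k M k a m2 = (boxOpR ((ℓ + 1) ^ k) (B1.aSeq a ((ℓ : ℝ) + 1) k) m2 M)⁻¹ := by
    unfold Gfine
    rw [fineOp_top]
  have := h k hk k hk le_rfl a m2 h1 h2 h3 h4 M hM μ x xe x' xe' hxe hxe' hne
  rw [wsum2, hG] at this
  exact this

/-- **(1.9) at `A = 0` on boxes with the LITERAL coefficient `a` of (1.6), printed quantifier order** — `B4Thm19ZeroBoxHolder.thm19_zero_box_holder_roww_coeff` re-threaded: `∃ δ₀ ∀ α ∃ c₀(α)`.  This is the form consumed by the [B6] two-level Hölder entry `…B6Ineq243HolderTwoLevelBox.ineq243_twoLevel_holder_wsum2`. [cite: Balaban1983RegularityDecay, Theorem (Prop. 2.1 of [1]) (1.9) p.573 with (1.6) p.572] -/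
theorem thm19_zero_box_holder_roww_coeff_unif (d ℓ : ℕ) (hℓ : 1 ≤ ℓ) (amin aplus m2plus : ℝ) (ha : 0 < amin) :
    ∃ δ₀ : ℝ, 0 < δ₀ ∧ ∀ (α : ℝ), 0 ≤ α → α < 1 → ∃ c₀ : ℝ, 0 < c₀ ∧ ∀ (k : ℕ), 1 ≤ k → ∀ (a m2 : ℝ), amin ≤ a → a ≤ aplus → 0 ≤ m2 →
      m2 ≤ m2plus → ∀ (M : Fin (d + 1) → ℕ), (∀ i, 1 ≤ M i) →
        ∀ (μ : Fin (d + 1)) (x xe x' xe' : ↥(boxDom (fun i => (ℓ + 1) ^ k * M i))),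
          xe.1 = x.1 + Pi.single μ 1 → xe'.1 = x'.1 + Pi.single μ 1 → x'.1 ≠ x.1 →
          ∑ z, |((((ℓ + 1) ^ k : ℕ) : ℝ) / supNorm (x'.1 - x.1)) ^ α * ((((ℓ + 1) ^ k : ℕ) : ℝ) *
                (((boxOpR ((ℓ + 1) ^ k) a m2 M)⁻¹ xe' z - (boxOpR ((ℓ + 1) ^ k) a m2 M)⁻¹ x' z)
                  - ((boxOpR ((ℓ + 1) ^ k) a m2 M)⁻¹ xe z - (boxOpR ((ℓ + 1) ^ k) a m2 M)⁻¹ x z)))|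
              * Real.exp (δ₀ * min (supNorm (x.1 - z.1)) (supNorm (x'.1 - z.1)) / (((ℓ + 1) ^ k : ℕ) : ℝ))
            ≤ c₀ := by
  obtain ⟨δ₀, hδ0, hA⟩ :=
    thm19_zero_box_holder_roww_unif d ℓ hℓ amin (aplus / (1 - ((((ℓ : ℝ) + 1)) ^ 2)⁻¹)) m2plus ha
  refine ⟨δ₀, hδ0, fun α hα0 hα1 => ?_⟩
  obtain ⟨c₀, hc0, h⟩ := hA α hα0 hα1
  refine ⟨c₀, hc0, ?_⟩
  intro k hk a m2 h1 h2 h3 h4 M hM μ x xe x' xe' hxe hxe' hne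
  obtain ⟨hr0, hr1⟩ := Linv_sq_bounds hℓ
  have hc := cK_pos hℓ hk
  have hA1 : amin ≤ a / cK ℓ k := by
    rw [le_div_iff₀ hc]
    calc amin * cK ℓ k ≤ amin * 1 := mul_le_mul_of_nonneg_left (cK_le_one hℓ hk) ha.le
      _ ≤ a := by linarith
  have hA2 : a / cK ℓ k ≤ aplus / (1 - ((((ℓ : ℝ) + 1)) ^ 2)⁻¹) :=
    div_le_div₀ (by linarith) h2 (by linarith) (oneSub_le_cK hℓ hk)
  have := h k hk (a / cK ℓ k) m2 hA1 hA2 h3 h4 M hM μ x xe x' xe' hxe hxe' hne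
  rwa [aSeq_div_cK hℓ hk] at this

end

end Literature.MathematicalPhysics.QuantumFieldTheory.Balaban1983to89.B4Thm19ZeroBoxHolderRateUnif
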